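import Literature.Geometry.Kaehler.ComplexTorusNefConeRealClasses
import Literature.Geometry.Kaehler.ComplexTorusPicardNumber
import Literature.Analysis.Complex.StronglyPositiveConeClosed
import HarnessLib

/-!
# Bauer 1998, Prop. 2.2 and Thm. 4.2 for a simple abelian variety: the semigroup of effective classes
# `N(X)` is finitely generated (equivalently, the nef cone `Nef(X)` is a rational polyhedral cone)
# if and only if `NS(X) ≅ ℤ`

Layer `Literature/Geometry/Kaehler`, namespace `Literature.Geometry.Kaehler.ComplexTorus`; lane
`lit-hodgefound`, seat p07 (generation 44), programme «THE NEF CONE OF AN ABELIAN VARIETY», file 50 of the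
seat lineage; sequel of `ComplexTorusNefConeSemipositive` (file 48: Bauer's Lemma 2.1, nef ⟺ `H ≥ 0` ⟺
effective for `η ∈ NS(X)`; §8 a semi-positive class of a SIMPLE torus is `0` or a polarisation; §9 the nef
threshold `s = inf {t | tL₁ - L₂ ≥ 0}`) and `ComplexTorusNefConeRealClasses` (file 49: `NS(X)` is generated by
polarisations; the nef cone of `NS_ℝ(X)`). Theorems only (no definition, no named fact, no instance, no
notation; net debt `0`).

THE SOURCE (Th. Bauer, *On the cone of curves of an abelian variety*, Amer. J. Math. 120 (1998), §1–§2, §4;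
held arXiv alg-geom/9712019, pp. 1–3, 5), VERBATIM. §1: "the semi-group
`N(X) = {λ ∈ NS(X) | λ = c₁(L) for some L ∈ Pic(X) with h⁰(X, L) > 0}` of the Néron–Severi group of `X`"
and the THEOREM: "Let `X` be an abelian variety over the field of complex numbers. Then the following
conditions are equivalent: (ia) The closed cone of curves `NE̅(X)` is rational polyhedral. (ib) The nef cone
`Nef(X)` is rational polyhedral. (ic) The semi-group `N(X)` is finitely generated. (ii) `X` is isogenous to a
product `X₁ × ⋯ × X_r` of mutually non-isogenous abelian varieties `Xᵢ` with `NS(Xᵢ) ≅ ℤ` for `1 ≤ i ≤ r`."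
§2, **Proposition 2.2.** "Let `X` be a simple abelian variety such that `N(X)` is finitely generated. Then
`NS(X) ≅ ℤ`." §4, **Theorem 4.2.** "The semi-group `N(X)` is finitely generated if and only if `NS(Xᵢ) ≅ ℤ`
and `nᵢ = 1` for `1 ≤ i ≤ r`" (for the decomposition `X ~ X₁^{n₁} × ⋯ × X_r^{n_r}` up to isogeny) — whose
"if" half for `r = 1`, `n₁ = 1` is "`N(X) = ⊕ᵢ ℤ⁺·[Nᵢ]` is finitely generated".

THIS FILE proves Prop. 2.2 and Thm. 4.2 FOR A SIMPLE ABELIAN VARIETY (`r = 1`), i.e. the main theorem's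
(ib) ⟺ (ic) ⟺ (ii) restricted to simple `X`, in the tree's vocabulary: `X = E/Φ(ℤ^ι)` a complex torus,
`NS(X) = {η | IsNSForm Φ η}` (`neronSeveriGroup Φ`), the hermitian form of `η` is `H_η(v, v) = η(iv, v)`, and
**`N(X)` is the set of SEMI-POSITIVE classes `{η ∈ NS(X) | H_η ≥ 0}`**, which by Lemma 2.1 / Lange Thm. 1.5.11
is exactly the set of classes `η` with `c₁ = ofRealForm(-η) = Σᵢ [Yᵢ]_e` an effective divisor class (the
tree's `semipos_iff_exists_sum_analyticCycleClass_eq`, cited not restated; §6 below gives the statements in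
that language too), and, on an abelian variety, exactly the set of NEF classes (file 48,
`IsAbelianVariety.semipos_iff_forall_curve`). "`N(X)` finitely generated" is: some finite `S ⊆ N(X)`
generates it as an additive monoid, `AddSubmonoid.closure S = N(X)`; "`Nef(X)` rational polyhedral" is: the
nef cone `{θ ∈ NS_ℝ(X) | H_θ ≥ 0}` of `NS_ℝ(X) = span_ℝ NS(X)` (file 49) is the convex cone `span_{ℝ≥0} S`
of a finite set `S ⊆ NS(X)` of integral classes; "`NS(X) ≅ ℤ`" is: the Picard number
`Module.finrank ℤ (neronSeveriGroup Φ)` (file `ComplexTorusPicardNumber`: `NS(X)` is free of finite rank) is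
`1`, and also, more concretely, `NS(X) = ℤ·M` for a polarisation `M`.

THE PROOF. Bauer's printed proof of Prop. 2.2 has two steps. Step 1 (assertion (2.1), ALREADY IN THE TREE
as `IsSimple.irrational_sInf_setOf_semipos_smul_sub`): for ample `L₁, L₂` with non-proportional classes the
nef threshold `s = inf {t ∈ ℝ | tL₁ - L₂ is nef}` is irrational, because a rational `s` would make
`n(sL₁ - L₂)` a semi-positive integral class that is neither `0` nor ample, so that "the neutral component of
`K(nL)` is a non-trivial abelian subvariety of `X`, contradicting the simplicity assumption". Step 2: finite
generation of `N(X)` (through "its intersection with `ℤ[L₁] ⊕ ℤ[L₂]` is finitely generated as well (cf.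
[Zie95])" and generators `Nᵢ = aᵢL₁ - bᵢL₂`) bounds the slopes `p₁/p₂` of the ample classes `p₁L₁ - p₂L₂`
away from `s` ("`p₁/p₂ ≥ q > s`"), which is absurd since they accumulate at `s`. HERE Step 2 is run in the
following equivalent convex-geometric form, which avoids the lattice-section lemma of [Zie95] and uses the
mechanism of Step 1 directly: the semi-positive class `P = sL₁ - L₂` lies on the boundary of the nef cone —
it is DEGENERATE, `H_P(w, w) = 0` for some `w ≠ 0` (§3, `exists_ne_zero_and_apply_sInf_smul_sub_eq_zero`:
otherwise positivity is open and `s` is not the infimum) — and it is the limit of the classes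
`b⁻¹(aL₁ - bL₂)`, `a/b ↓ s`, of semi-positive INTEGRAL classes `aL₁ - bL₂ ∈ N(X)` (§3,
`sInf_smul_sub_mem_closure`). If `N(X)` is generated by `N₁, …, N_k` (as a monoid, or just as a convex cone),
these lie in the cone `C = Σ ℝ≥0·Nᵢ`, which is CLOSED (§1: a finitely generated convex cone whose non-zero
generators are semi-positive is closed — Hiriart-Urruty–Lemaréchal Prop. A.1.4.7, the tree's
`isClosed_span_nnreal_of_isCompact`, since `0 ∉ co {Nᵢ}`), so `P = Σ cᵢ Nᵢ` with `cᵢ ≥ 0`; then every `Nᵢ`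
with `cᵢ > 0` is degenerate at `w`, hence — a semi-positive class of a simple torus being `0` or a
polarisation (file 48 §8, the "`K(nL)⁰`" step of Bauer's proof) — equal to `0` (§2); so `P = 0`,
`L₂ = sL₁`, and integrality of `L₁ ≠ 0`, `L₂` on the lattice makes `s` rational: the classes of `L₁`, `L₂`
ARE proportional. As `NS(X)` is generated by polarisations (file 49 §1), `NS(X) ⊗ ℚ = ℚ·[L]` and
`rk NS(X) = 1`.

## Contents

* §1 `zero_notMem_convexHull_of_forall_semipos`, **`isClosed_span_nnreal_of_forall_semipos`**: the convex cone
  generated by finitely many non-zero semi-positive real `(1,1)`-forms is closed.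
* §2 `IsSimple.eq_zero_of_semipos_of_apply_I_smul_self_eq_zero` (a semi-positive class of `NS(X)`, `X` simple,
  with a non-zero isotropic vector is `0`), **`IsSimple.eq_zero_of_mem_span_nnreal_of_apply_I_smul_self_eq_zero`**
  (the same for every element of the cone generated by semi-positive classes).
* §3 the threshold class `P = sL₁ - L₂`, `s = inf {t | tL₁ - L₂ ≥ 0}`, of two positive `(1,1)`-forms:
  `exists_ne_zero_and_apply_sInf_smul_sub_eq_zero` (`P` is degenerate) and `sInf_smul_sub_mem_closure` (`P` is in
  the closure of every cone containing the semi-positive integral combinations `aL₁ - bL₂`);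
  `exists_rat_cast_smul_eq_of_smul_eq` (`sL₁ = L₂` for `L₁, L₂ ∈ NS(X)` forces a rational `s`).
* §4 **`IsSimple.exists_rat_cast_smul_eq_of_forall_semipos_mem_span_nnreal`** (THE CORE OF PROP. 2.2: on a
  simple torus, if all semi-positive classes of `NS(X)` lie in the convex cone generated by finitely many of
  them, any two polarisations have proportional classes),
  `IsSimple.exists_eq_rat_cast_smul_of_forall_semipos_mem_span_nnreal` (then `NS(X) ⊗ ℚ = ℚ·[L]` for any
  polarisation `L`) and
  **`IsSimple.finrank_neronSeveriGroup_eq_one_of_forall_semipos_mem_span_nnreal`** (`rk NS(X) = 1`).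
* §5 **PROP. 2.2 AS PRINTED**, `IsSimple.finrank_neronSeveriGroup_eq_one_of_addSubmonoidClosure_eq` (`X` simple
  abelian variety, `N(X)` finitely generated ⇒ `rk NS(X) = 1`), the nef-cone form
  `IsSimple.finrank_neronSeveriGroup_eq_one_of_span_nnreal_eq` ((ib) ⇒ (ii) for simple `X`), and the converse
  halves of Thm. 4.2 for `r = 1`: `exists_isRiemannForm_forall_eq_int_cast_smul_of_finrank_eq_one` (`rk NS(X) = 1` on an
  abelian variety ⇒ `NS(X) = ℤ·M` for a polarisation `M`),
  **`exists_addSubmonoidClosure_singleton_eq_of_finrank_eq_one`** (`N(X) = ℤ⁺·[M]` is finitely generated),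
  `exists_span_nnreal_singleton_eq_of_finrank_eq_one` (`Nef(X) = ℝ≥0·[M]` is rational polyhedral), and the
  equivalences `IsSimple.exists_addSubmonoidClosure_eq_iff_finrank_eq_one`,
  `IsSimple.exists_span_nnreal_eq_iff_finrank_eq_one` (THE THEOREM, (ic) ⟺ (ii) ⟺ (ib), for simple `X`).
* §6 the same with `N(X)` written as the set of EFFECTIVE classes `{η | ofRealForm(-η) = Σᵢ [Yᵢ]_e}`
  (`setOf_exists_sum_analyticCycleClass_eq`, `IsSimple.finrank_neronSeveriGroup_eq_one_of_addSubmonoidClosure_eq_effective`,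
  `IsSimple.exists_addSubmonoidClosure_eq_effective_iff_finrank_eq_one`), as the set of NEF classes
  (`IsAbelianVariety.setOf_forall_curve_nonneg_eq`, `IsSimple.finrank_neronSeveriGroup_eq_one_of_addSubmonoidClosure_eq_nef`),
  and with the nef cone of `NS_ℝ(X)` defined by degrees on curves (`IsAbelianVariety.setOf_mem_span_forall_curve_nonneg_eq`,
  `IsSimple.finrank_neronSeveriGroup_eq_one_of_span_nnreal_eq_nef`).
* §7 (appended, generation 44 row g44-#2) RATIONAL generators: `exists_pos_isNSForm_nat_cast_smul_of_mem_span_rat`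
  (every class of `NS_ℚ(X)` has a positive integer multiple in `NS(X)`),
  **`IsSimple.finrank_neronSeveriGroup_eq_one_of_span_nnreal_eq_of_subset_span_rat`** ((ib) ⇒ (ii) with
  `Nef(X)` spanned over `ℝ≥0` by finitely many classes of `NS_ℚ(X)`; also `…_eq_nef_of_subset_span_rat` with the
  nef cone defined by curves), and the rational boundary classes of the nef cone of a simple torus:
  `IsSimple.eq_zero_of_mem_span_rat_of_semipos_of_apply_I_smul_self_eq_zero`,
  **`IsSimple.eq_zero_or_forall_pos_of_mem_span_rat_of_semipos`** (a nef class of `NS_ℚ(X)` is `0` or ample —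
  the mechanism of Bauer's assertion (2.1)), `IsSimple.eq_zero_or_forall_pos_of_mem_span_rat_of_forall_curve_nonneg`.

## References

* [Bauer1998ConeOfCurves] Th. Bauer, *On the cone of curves of an abelian variety*, Amer. J. Math. 120 (1998)
  997–1006: §1 (the semi-group `N(X)`, the Theorem (ia) ⟺ (ib) ⟺ (ic) ⟺ (ii)), §2 Prop. 2.2 and its proof,
  §4 Thm. 4.2 (held: arXiv alg-geom/9712019, pp. 1–3, 5).
* [HiriarturrutyLemarechal2001] J.-B. Hiriart-Urruty, C. Lemaréchal, *Fundamentals of Convex Analysis*,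
  Springer 2001, Ch. A Prop. 1.4.7 (the cone generated by a compact set `S` with `0 ∉ co S` is closed).
* [Lange2023AbelianVarietiesComplex] H. Lange, *Abelian Varieties over the Complex Numbers*, Springer 2023,
  §1.3.1 Exercise 1.3.4 (10) (the Picard number), §1.5.4 Thm. 1.5.11, §2.2.5 Exercise (1).
* [Rockafellar1970] R. T. Rockafellar, *Convex Analysis*, Princeton 1970, §19 (polyhedral convex cones; cited by
  Bauer as [Roc70] for "the elementary properties of cones used here").
-/

noncomputable section

open scoped Manifold ComplexOrder NNReal
open Complex Set Function Module Filter Topology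

universe u

namespace Literature.Geometry.Kaehler

namespace ComplexTorus

/-! ### §1 The convex cone generated by finitely many non-zero semi-positive `(1,1)`-forms is closed -/

section Cone

variable {E : Type*} [NormedAddCommGroup E] [NormedSpace ℂ E]

/-- A real `(1,1)`-form whose hermitian form `H_η(v, v) = η(iv, v)` vanishes identically is `0`
(`H_η ≥ 0` with every vector isotropic: `η(u, ·) = 0` by `apply_eq_zero_of_self_eq_zero`). [folklore] -/
private theorem eq_zero_of_forall_apply_I_smul_self_eq_zero {η : E [⋀^Fin 2]→L[ℝ] ℝ}
    (h11 : ∀ u v : E, η ![I • u, I • v] = η ![u, v]) (h0 : ∀ v : E, η ![I • v, v] = 0) : η = 0 := by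
  ext u
  have hu : u = ![u 0, u 1] := by
    funext i
    fin_cases i <;> rfl
  rw [hu, ContinuousAlternatingMap.coe_zero, Pi.zero_apply]
  exact apply_eq_zero_of_self_eq_zero h11 (fun w ↦ (h0 w).ge) (h0 (u 0)) (u 1)

/-- **`0 ∉ co G` for a set `G` of non-zero positive semi-definite `(1,1)`-forms**: a convex combination
`Σ wᵢ Nᵢ = 0` with `wᵢ > 0` (Carathéodory) gives `Σ wᵢ H_{Nᵢ}(v, v) = 0`, so every `H_{Nᵢ}` vanishes
identically and `Nᵢ = 0`. (The hypothesis "`0 ∉ co S`" of Hiriart-Urruty–Lemaréchal, Prop. A.1.4.7, for the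
generators of the effective cone.) [cite: HiriarturrutyLemarechal2001, Ch. A Prop. 1.4.7] -/
theorem zero_notMem_convexHull_of_forall_semipos {G : Set (E [⋀^Fin 2]→L[ℝ] ℝ)}
    (h11 : ∀ η ∈ G, ∀ u v : E, η ![I • u, I • v] = η ![u, v])
    (hpsd : ∀ η ∈ G, ∀ v : E, 0 ≤ η ![I • v, v]) (h0 : (0 : E [⋀^Fin 2]→L[ℝ] ℝ) ∉ G) :
    (0 : E [⋀^Fin 2]→L[ℝ] ℝ) ∉ convexHull ℝ G := by
  intro hmem
  obtain ⟨κ, _, z, w, hzG, -, hw, hw1, hsum⟩ := eq_pos_convex_span_of_mem_convexHull hmem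
  have hκ : Nonempty κ := by
    by_contra hκ
    rw [not_nonempty_iff] at hκ
    rw [Finset.univ_eq_empty_iff.2 hκ, Finset.sum_empty] at hw1
    exact zero_ne_one hw1
  obtain ⟨i₀⟩ := hκ
  have hzi₀ : z i₀ ∈ G := hzG ⟨i₀, rfl⟩
  have hz0 : z i₀ = 0 := by
    refine eq_zero_of_forall_apply_I_smul_self_eq_zero (h11 _ hzi₀) fun v ↦ ?_
    have hterm : ∀ i, 0 ≤ w i * (z i) ![I • v, v] := fun i ↦
      mul_nonneg (hw i).le (hpsd _ (hzG ⟨i, rfl⟩) v)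
    have hsum0 : ∑ i, w i * (z i) ![I • v, v] = 0 := by
      have h := congrArg (fun θ : E [⋀^Fin 2]→L[ℝ] ℝ ↦ θ ![I • v, v]) hsum
      simpa only [ContinuousAlternatingMap.sum_apply, ContinuousAlternatingMap.smul_apply, smul_eq_mul,
        ContinuousAlternatingMap.coe_zero, Pi.zero_apply] using h
    have h := (Finset.sum_eq_zero_iff_of_nonneg fun i _ ↦ hterm i).1 hsum0 i₀ (Finset.mem_univ _)
    rcases mul_eq_zero.1 h with h | h
    · exact absurd h (hw i₀).ne'
    · exact h
  rw [hz0] at hzi₀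
  exact h0 hzi₀

/-- **The convex cone `Σᵢ ℝ≥0·Nᵢ` generated by finitely many non-zero positive semi-definite `(1,1)`-forms
is closed** (Hiriart-Urruty–Lemaréchal, Prop. A.1.4.7: "Let `S` be a nonempty compact set such that
`0 ∉ co S`. Then `cl cone S = ℝ⁺(co S) = cone S`" — the tree's `isClosed_span_nnreal_of_isCompact`; a finite set
is compact and `0 ∉ co S` by `zero_notMem_convexHull_of_forall_semipos`). This is the "elementary property of
cones" (Bauer, §4, citing [Roc70]) that makes a finitely generated effective cone closed.
[cite: HiriarturrutyLemarechal2001, Ch. A Prop. 1.4.7] [cite: Bauer1998ConeOfCurves, §4 ("the elementary properties of cones used here")] -/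
theorem isClosed_span_nnreal_of_forall_semipos [FiniteDimensional ℝ E] {G : Set (E [⋀^Fin 2]→L[ℝ] ℝ)}
    (hG : G.Finite) (h11 : ∀ η ∈ G, ∀ u v : E, η ![I • u, I • v] = η ![u, v])
    (hpsd : ∀ η ∈ G, ∀ v : E, 0 ≤ η ![I • v, v]) (h0 : (0 : E [⋀^Fin 2]→L[ℝ] ℝ) ∉ G) :
    IsClosed (Submodule.span ℝ≥0 G : Set (E [⋀^Fin 2]→L[ℝ] ℝ)) := by
  haveI : FiniteDimensional ℝ (E [⋀^Fin 2]→L[ℝ] ℝ) := ChartOp1.finiteDimensional_continuousAlternatingMap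
  exact Literature.Analysis.Complex.PositiveForm.isClosed_span_nnreal_of_isCompact hG.isCompact
    (zero_notMem_convexHull_of_forall_semipos h11 hpsd h0)

/-- Real non-negative multiples stay in an `ℝ≥0`-cone. [folklore] -/
private theorem smul_mem_span_nnreal_of_nonneg {G : Set (E [⋀^Fin 2]→L[ℝ] ℝ)} {c : ℝ} (hc : 0 ≤ c)
    {x : E [⋀^Fin 2]→L[ℝ] ℝ} (hx : x ∈ Submodule.span ℝ≥0 G) : c • x ∈ Submodule.span ℝ≥0 G := by
  rw [show c • x = (⟨c, hc⟩ : ℝ≥0) • x from rfl]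
  exact Submodule.smul_mem _ _ hx

end Cone

/-! ### §2 Simple tori: degenerate elements of the cone of semi-positive classes vanish -/

section Simple

variable {ι : Type*} [Fintype ι] [DecidableEq ι] {E : Type*} [NormedAddCommGroup E] [NormedSpace ℂ E]
  (Φ : (ι → ℝ) ≃L[ℝ] E)

/-- **On a simple complex torus a semi-positive class `η ∈ NS(X)` with a non-zero isotropic vector
(`H_η(w, w) = 0`, `w ≠ 0`) is `0`**: by file 48 §8 (`IsSimple.eq_zero_or_isRiemannForm_of_semipos`, Bauer's
"the neutral component of `K(nL)` is a non-trivial abelian subvariety of `X`, contradicting the simplicity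
assumption") `η` is `0` or a polarisation, and a polarisation has `H > 0`. [cite: Bauer1998ConeOfCurves, §2 Prop. 2.2 (proof)]
[cite: Lange2023AbelianVarietiesComplex, §1.5.4 (1.22)] -/
theorem IsSimple.eq_zero_of_semipos_of_apply_I_smul_self_eq_zero (hS : IsSimple Φ) {η : E [⋀^Fin 2]→L[ℝ] ℝ}
    (hη : IsNSForm Φ η) (hpsd : ∀ v : E, 0 ≤ η ![I • v, v]) {w : E} (hw : w ≠ 0) (h0 : η ![I • w, w] = 0) :
    η = 0 :=
  (hS.eq_zero_or_isRiemannForm_of_semipos Φ hη hpsd).elim id fun h ↦ absurd h0 (h.2.2 w hw).ne'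

/-- **On a simple complex torus, an element `θ = Σ cᵢ Nᵢ` (`cᵢ ≥ 0`) of the convex cone generated by
semi-positive classes `Nᵢ ∈ NS(X)` which has a non-zero isotropic vector `w` is `0`**: `H_θ(w, w) = 0` forces
`H_{Nᵢ}(w, w) = 0` whenever `cᵢ > 0`, so those `Nᵢ` vanish. [cite: Bauer1998ConeOfCurves, §2 Prop. 2.2 (proof)] -/
theorem IsSimple.eq_zero_of_mem_span_nnreal_of_apply_I_smul_self_eq_zero (hS : IsSimple Φ)
    {G : Set (E [⋀^Fin 2]→L[ℝ] ℝ)} (hG : ∀ η ∈ G, IsNSForm Φ η ∧ ∀ v : E, 0 ≤ η ![I • v, v])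
    {θ : E [⋀^Fin 2]→L[ℝ] ℝ} (hθ : θ ∈ Submodule.span ℝ≥0 G) {w : E} (hw : w ≠ 0)
    (h0 : θ ![I • w, w] = 0) : θ = 0 := by
  suffices h : (∀ v : E, 0 ≤ θ ![I • v, v]) ∧ (θ ![I • w, w] = 0 → θ = 0) from h.2 h0
  clear h0
  induction hθ using Submodule.span_induction with
  | mem η hη =>
    exact ⟨(hG η hη).2, fun h ↦
      hS.eq_zero_of_semipos_of_apply_I_smul_self_eq_zero Φ (hG η hη).1 (hG η hη).2 hw h⟩
  | zero => exact ⟨fun v ↦ by rw [ContinuousAlternatingMap.coe_zero, Pi.zero_apply], fun _ ↦ rfl⟩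
  | add x y _ _ ihx ihy =>
    refine ⟨fun v ↦ ?_, fun h ↦ ?_⟩
    · rw [ContinuousAlternatingMap.add_apply]
      exact add_nonneg (ihx.1 v) (ihy.1 v)
    · rw [ContinuousAlternatingMap.add_apply] at h
      have hx : x ![I • w, w] = 0 := by linarith [ihx.1 w, ihy.1 w]
      have hy : y ![I • w, w] = 0 := by linarith [ihx.1 w, ihy.1 w]
      rw [ihx.2 hx, ihy.2 hy, add_zero]
  | smul c x _ ih =>
    refine ⟨fun v ↦ ?_, fun h ↦ ?_⟩
    · rw [NNReal.smul_def, ContinuousAlternatingMap.smul_apply, smul_eq_mul]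
      exact mul_nonneg c.2 (ih.1 v)
    · rw [NNReal.smul_def, ContinuousAlternatingMap.smul_apply, smul_eq_mul] at h
      rcases mul_eq_zero.1 h with hc | hx
      · rw [NNReal.smul_def, hc, zero_smul]
      · rw [ih.2 hx, smul_zero]

end Simple

/-! ### §3 The threshold class `P = sL₁ - L₂`, `s = inf {t | tL₁ - L₂ ≥ 0}`: degenerate, and a limit of the
semi-positive integral classes `b⁻¹(aL₁ - bL₂)` -/

section Threshold

variable {E : Type*} [NormedAddCommGroup E] [NormedSpace ℂ E]

/-- **The nef threshold class is degenerate**: for positive `(1,1)`-forms `L₁`, `L₂` (on `E ≠ 0`) and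
`s = inf T`, `T = {t | tL₁ - L₂ ≥ 0} = [s, ∞)` (file 48, `setOf_semipos_smul_sub_eq_Ici`), the semi-positive
form `sL₁ - L₂` has a non-zero isotropic vector — were it positive definite, `(s - δ)L₁ - L₂ > 0` for small
`δ > 0` by openness of positivity (`exists_pos_forall_add_smul_apply_I_smul_self_pos`), against `s = inf T`.
(Bauer: "`L = sL₁ - L₂` … is certainly not ample".) [cite: Bauer1998ConeOfCurves, §2 Prop. 2.2 (proof: "`L`, and hence `nL`, is certainly not ample")]
[cite: Huybrechts2005, §3.1 Cor. 3.1.8] -/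
theorem exists_ne_zero_and_apply_sInf_smul_sub_eq_zero [FiniteDimensional ℂ E] [Nontrivial E]
    {L₁ L₂ : E [⋀^Fin 2]→L[ℝ] ℝ}
    (h₁ : ∀ u v : E, L₁ ![I • u, I • v] = L₁ ![u, v]) (h₁pos : ∀ v : E, v ≠ 0 → 0 < L₁ ![I • v, v])
    (h₂ : ∀ u v : E, L₂ ![I • u, I • v] = L₂ ![u, v]) (h₂pos : ∀ v : E, v ≠ 0 → 0 < L₂ ![I • v, v]) :
    ∃ w : E, w ≠ 0 ∧
      (sInf {t : ℝ | ∀ v : E, 0 ≤ (t • L₁ - L₂) ![I • v, v]} • L₁ - L₂) ![I • w, w] = 0 := by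
  set T := {t : ℝ | ∀ v : E, 0 ≤ (t • L₁ - L₂) ![I • v, v]} with hT
  obtain ⟨hIci, -, hsT⟩ := setOf_semipos_smul_sub_eq_Ici h₁ h₁pos h₂ h₂pos
  by_contra hne
  push Not at hne
  have hpos : ∀ w : E, w ≠ 0 → 0 < (sInf T • L₁ - L₂) ![I • w, w] := fun w hw ↦
    (hsT w).lt_of_ne (hne w hw).symm
  have h11 : ∀ u v : E, (sInf T • L₁ - L₂) ![I • u, I • v] = (sInf T • L₁ - L₂) ![u, v] := fun u v ↦ by
    simp only [ContinuousAlternatingMap.sub_apply, ContinuousAlternatingMap.smul_apply, h₁ u v, h₂ u v]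
  have hneg : ∀ u v : E, (-L₁) ![I • u, I • v] = (-L₁) ![u, v] := fun u v ↦ by
    simp only [ContinuousAlternatingMap.neg_apply, h₁ u v]
  obtain ⟨δ, hδ, hpd⟩ := exists_pos_forall_add_smul_apply_I_smul_self_pos h11 hpos hneg
  have hmem : sInf T - δ ∈ T := fun v ↦ by
    have h := apply_I_smul_self_nonneg_of_pos hpd v
    have hform : ((sInf T - δ) • L₁ - L₂) ![I • v, v] = (sInf T • L₁ - L₂ + δ • (-L₁)) ![I • v, v] := by
      simp only [ContinuousAlternatingMap.sub_apply, ContinuousAlternatingMap.add_apply,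
        ContinuousAlternatingMap.smul_apply, ContinuousAlternatingMap.neg_apply, smul_eq_mul]
      ring
    rw [hform]
    exact h
  have hle : sInf T ≤ sInf T - δ := by
    have h : sInf T - δ ∈ Ici (sInf T) := hIci ▸ hmem
    exact h
  linarith

/-- **The threshold class is a limit of semi-positive integral combinations**: with `s = inf T > 0` as
above, `sL₁ - L₂` lies in the closure of every `ℝ≥0`-cone `C` containing the classes `aL₁ - bL₂`
(`a, b ∈ ℕ`, `b ≥ 1`) with `a/b ∈ T` — indeed `b⁻¹(aL₁ - bL₂) = (a/b)L₁ - L₂ ∈ C` for `a = ⌊bs⌋ + 1`, at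
distance `≤ ‖L₁‖/b` from `sL₁ - L₂`. (Bauer's "fix large integers `p₁, p₂` such that
`s < p₁/p₂ < s + ε`. The line bundle `A = p₁L₁ - p₂L₂` … is then ample and therefore effective".)
[cite: Bauer1998ConeOfCurves, §2 Prop. 2.2 (proof, inequality (2.2))] -/
theorem sInf_smul_sub_mem_closure [FiniteDimensional ℂ E] [Nontrivial E] {L₁ L₂ : E [⋀^Fin 2]→L[ℝ] ℝ}
    (h₁ : ∀ u v : E, L₁ ![I • u, I • v] = L₁ ![u, v]) (h₁pos : ∀ v : E, v ≠ 0 → 0 < L₁ ![I • v, v])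
    (h₂ : ∀ u v : E, L₂ ![I • u, I • v] = L₂ ![u, v]) (h₂pos : ∀ v : E, v ≠ 0 → 0 < L₂ ![I • v, v])
    {C : Set (E [⋀^Fin 2]→L[ℝ] ℝ)} (hCsmul : ∀ c : ℝ, 0 ≤ c → ∀ x ∈ C, c • x ∈ C)
    (hC : ∀ a b : ℕ, 0 < b → (∀ v : E, 0 ≤ ((((a : ℝ) / b) • L₁ - L₂)) ![I • v, v]) →
      (a : ℝ) • L₁ - (b : ℝ) • L₂ ∈ C) :
    sInf {t : ℝ | ∀ v : E, 0 ≤ (t • L₁ - L₂) ![I • v, v]} • L₁ - L₂ ∈ closure C := by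
  obtain ⟨hIci, hspos, -⟩ := setOf_semipos_smul_sub_eq_Ici h₁ h₁pos h₂ h₂pos
  set s := sInf {t : ℝ | ∀ v : E, 0 ≤ (t • L₁ - L₂) ![I • v, v]} with hs
  refine Metric.mem_closure_iff.2 fun ε hε ↦ ?_
  obtain ⟨b, hb⟩ := exists_nat_gt (‖L₁‖ / ε)
  have hbpos : 0 < (b : ℝ) := lt_of_le_of_lt (div_nonneg (norm_nonneg _) hε.le) hb
  have hbpos' : 0 < b := by exact_mod_cast hbpos
  set a : ℕ := ⌊(b : ℝ) * s⌋₊ + 1 with ha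
  have has : (b : ℝ) * s < a := by
    rw [ha]
    push_cast
    exact Nat.lt_floor_add_one _
  have hale : (a : ℝ) ≤ b * s + 1 := by
    rw [ha]
    push_cast
    linarith [Nat.floor_le (mul_nonneg hbpos.le hspos.le)]
  set t : ℝ := (a : ℝ) / b with ht
  have hst : s < t := by
    rw [ht, lt_div_iff₀ hbpos]
    linarith
  have hts : t - s ≤ 1 / b := by
    rw [ht, div_sub' (ne_of_gt hbpos), div_le_div_iff_of_pos_right hbpos]
    linarith
  have htT : t ∈ {t : ℝ | ∀ v : E, 0 ≤ (t • L₁ - L₂) ![I • v, v]} := by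
    rw [hIci]
    exact hst.le
  have hmemC : (a : ℝ) • L₁ - (b : ℝ) • L₂ ∈ C := hC a b hbpos' (by simpa only [mem_setOf_eq] using htT)
  refine ⟨(b : ℝ)⁻¹ • ((a : ℝ) • L₁ - (b : ℝ) • L₂), hCsmul _ (inv_nonneg.2 hbpos.le) _ hmemC, ?_⟩
  have hform : (b : ℝ)⁻¹ • ((a : ℝ) • L₁ - (b : ℝ) • L₂) = t • L₁ - L₂ := by
    ext v
    simp only [ContinuousAlternatingMap.sub_apply, ContinuousAlternatingMap.smul_apply, smul_eq_mul, ht]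
    field_simp
  rw [hform, dist_eq_norm]
  have hdiff : s • L₁ - L₂ - (t • L₁ - L₂) = (s - t) • L₁ := by
    ext v
    simp only [ContinuousAlternatingMap.sub_apply, ContinuousAlternatingMap.smul_apply, smul_eq_mul]
    ring
  rw [hdiff, norm_smul, Real.norm_eq_abs, abs_sub_comm, abs_of_pos (sub_pos.2 hst)]
  have hL₁ε : ‖L₁‖ < b * ε := by
    have h := (div_lt_iff₀ hε).1 hb
    linarith [mul_comm (b : ℝ) ε]
  calc (t - s) * ‖L₁‖ ≤ 1 / b * ‖L₁‖ := by gcongr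
    _ < 1 / b * (b * ε) := by gcongr
    _ = ε := by field_simp

variable {ι : Type*} [Fintype ι] [DecidableEq ι] (Φ : (ι → ℝ) ≃L[ℝ] E)

/-- **`sL₁ = L₂` for two Néron–Severi classes forces `s ∈ ℚ` (or `L₁ = L₂ = 0`)**: both forms take integer
values on pairs of lattice vectors, and a non-zero real `2`-form takes a non-zero value on some such pair
(the lattice spans `E`, `twoForm_eq_zero_of_forall_latticeVec_eq_zero`). In any case the classes are
RATIONALLY proportional. [cite: Lange2023AbelianVarietiesComplex, §1.2.2 Prop. 1.2.9 (`E(Λ, Λ) ⊆ ℤ`)] -/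
theorem exists_rat_cast_smul_eq_of_smul_eq {L₁ L₂ : E [⋀^Fin 2]→L[ℝ] ℝ} (h₁ : IsNSForm Φ L₁) (h₂ : IsNSForm Φ L₂)
    {s : ℝ} (hs : s • L₁ = L₂) : ∃ q : ℚ, (q : ℝ) • L₁ = L₂ := by
  by_cases hex : ∃ m n : ι → ℤ, L₁ ![latticeVec Φ m, latticeVec Φ n] ≠ 0
  · obtain ⟨m, n, hmn⟩ := hex
    obtain ⟨k₁, hk₁⟩ := h₁.integral m n
    obtain ⟨k₂, hk₂⟩ := h₂.integral m n
    have hk₁0 : (k₁ : ℝ) ≠ 0 := hk₁ ▸ hmn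
    have hsk : s * k₁ = k₂ := by
      rw [← hk₁, ← hk₂, ← hs, ContinuousAlternatingMap.smul_apply, smul_eq_mul]
    refine ⟨(k₂ : ℚ) / k₁, ?_⟩
    have hq : (((k₂ : ℚ) / k₁ : ℚ) : ℝ) = s := by
      push_cast
      rw [← hsk, mul_div_cancel_right₀ _ hk₁0]
    rw [hq, hs]
  · push Not at hex
    have hL₁ : L₁ = 0 := by
      have h1 : ∀ (m : ι → ℤ) (v : E), L₁ ![latticeVec Φ m, v] = 0 := fun m ↦
        twoForm_eq_zero_of_forall_latticeVec_eq_zero Φ L₁ _ (hex m)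
      have h2 : ∀ v w : E, L₁ ![v, w] = 0 := fun v ↦
        twoForm_eq_zero_of_forall_latticeVec_eq_zero Φ L₁ v fun m ↦ by rw [twoForm_swap, h1, neg_zero]
      ext u
      have hu : u = ![u 0, u 1] := by
        funext i
        fin_cases i <;> rfl
      rw [hu, ContinuousAlternatingMap.coe_zero, Pi.zero_apply]
      exact h2 _ _
    refine ⟨0, ?_⟩
    rw [Rat.cast_zero, zero_smul, ← hs, hL₁, smul_zero]

end Threshold

/-! ### §4 Prop. 2.2, the core: finitely many semi-positive classes generating the semi-positive cone force
all polarisations to be proportional, `NS(X) ⊗ ℚ = ℚ·[L]`, `rk NS(X) = 1` -/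

section Proportional

variable {ι : Type*} [Fintype ι] [DecidableEq ι] {E : Type*} [NormedAddCommGroup E] [NormedSpace ℂ E]
  (Φ : (ι → ℝ) ≃L[ℝ] E)

/-- **Bauer 1998, Prop. 2.2 — THE CORE.** Let `X = E/Λ` be a SIMPLE complex torus and suppose that the
semi-positive classes of `NS(X)` (= the effective classes `N(X)`, Lemma 2.1) all lie in the convex cone
`Σᵢ ℝ≥0·Nᵢ` generated by a FINITE set `G = {Nᵢ}` of semi-positive classes of `NS(X)` (e.g. `N(X)` is a finitely
generated semigroup, or `Nef(X)` is a rational polyhedral cone). Then any two polarisations `L₁`, `L₂` have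
proportional classes: `qL₁ = L₂` for some `q ∈ ℚ`. Proof: with `s = inf {t | tL₁ - L₂ ≥ 0}` the class
`P = sL₁ - L₂` is degenerate (§3) and is the limit of `b⁻¹(aL₁ - bL₂)` with `aL₁ - bL₂` semi-positive
integral, hence in the cone; the cone is closed (§1), so `P` is in it, so `P = 0` (§2), `L₂ = sL₁`, `s ∈ ℚ`
(§3). Contrapositive of the printed "Assume to the contrary that `rk NS(X) > 1` and choose ample line bundles
`L₁` and `L₂` whose classes are not proportional in `NS_ℚ(X)` …". [cite: Bauer1998ConeOfCurves, §2 Prop. 2.2 (statement and proof)] -/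
theorem IsSimple.exists_rat_cast_smul_eq_of_forall_semipos_mem_span_nnreal (hS : IsSimple Φ)
    {G : Set (E [⋀^Fin 2]→L[ℝ] ℝ)} (hGfin : G.Finite)
    (hG : ∀ η ∈ G, IsNSForm Φ η ∧ ∀ v : E, 0 ≤ η ![I • v, v])
    (hgen : ∀ η : E [⋀^Fin 2]→L[ℝ] ℝ, IsNSForm Φ η → (∀ v : E, 0 ≤ η ![I • v, v]) →
      η ∈ Submodule.span ℝ≥0 G)
    {L₁ L₂ : E [⋀^Fin 2]→L[ℝ] ℝ} (h₁ : IsRiemannForm Φ L₁) (h₂ : IsRiemannForm Φ L₂) :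
    ∃ q : ℚ, (q : ℝ) • L₁ = L₂ := by
  classical
  haveI := finiteDimensional_complex Φ
  haveI : FiniteDimensional ℝ E := LinearEquiv.finiteDimensional Φ.toLinearEquiv
  rcases subsingleton_or_nontrivial E with hE | hE
  · refine ⟨0, ?_⟩
    ext v
    rw [Subsingleton.elim v 0, ContinuousAlternatingMap.map_zero, ContinuousAlternatingMap.map_zero]
  -- the non-zero generators
  obtain ⟨G', hG'⟩ : ∃ G' : Set (E [⋀^Fin 2]→L[ℝ] ℝ), G' = {η | η ∈ G ∧ η ≠ 0} := ⟨_, rfl⟩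
  have hG'fin : G'.Finite := by
    rw [hG']
    exact hGfin.subset fun η hη ↦ hη.1
  have hG'G : ∀ η ∈ G', η ∈ G := fun η hη ↦ by
    rw [hG'] at hη
    exact hη.1
  have h0G' : (0 : E [⋀^Fin 2]→L[ℝ] ℝ) ∉ G' := fun h ↦ by
    rw [hG'] at h
    exact h.2 rfl
  have hspan : Submodule.span ℝ≥0 G ≤ Submodule.span ℝ≥0 G' := by
    have h : G ⊆ insert 0 G' := fun η hη ↦ by
      by_cases h : η = 0
      · exact Set.mem_insert_iff.2 (Or.inl h)
      · refine Set.mem_insert_iff.2 (Or.inr ?_)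
        rw [hG']
        exact ⟨hη, h⟩
    calc Submodule.span ℝ≥0 G ≤ Submodule.span ℝ≥0 (insert 0 G') := Submodule.span_mono h
      _ = Submodule.span ℝ≥0 G' := Submodule.span_insert_zero
  have hclosed : IsClosed (Submodule.span ℝ≥0 G' : Set (E [⋀^Fin 2]→L[ℝ] ℝ)) :=
    isClosed_span_nnreal_of_forall_semipos hG'fin (fun η hη ↦ (hG η (hG'G η hη)).1.type_one_one)
      (fun η hη ↦ (hG η (hG'G η hη)).2) h0G'
  -- the threshold class `P = sL₁ - L₂` lies in the closed cone
  set T := {t : ℝ | ∀ v : E, 0 ≤ (t • L₁ - L₂) ![I • v, v]} with hT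
  have hPcl : sInf T • L₁ - L₂ ∈ closure (Submodule.span ℝ≥0 G' : Set (E [⋀^Fin 2]→L[ℝ] ℝ)) := by
    refine sInf_smul_sub_mem_closure h₁.1 h₁.2.2 h₂.1 h₂.2.2
      (fun c hc x hx ↦ smul_mem_span_nnreal_of_nonneg hc hx) fun a b hb hab ↦ hspan (hgen _ ?_ fun v ↦ ?_)
    · have ha : IsNSForm Φ ((a : ℝ) • L₁) := by
        rw [Nat.cast_smul_eq_nsmul]
        exact (mem_neronSeveriGroup_iff Φ).1
          (AddSubgroup.nsmul_mem _ (mem_neronSeveriGroup_of_isRiemannForm Φ h₁) a)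
      have hb' : IsNSForm Φ ((b : ℝ) • L₂) := by
        rw [Nat.cast_smul_eq_nsmul]
        exact (mem_neronSeveriGroup_iff Φ).1
          (AddSubgroup.nsmul_mem _ (mem_neronSeveriGroup_of_isRiemannForm Φ h₂) b)
      exact (mem_neronSeveriGroup_iff Φ).1
        (AddSubgroup.sub_mem _ ((mem_neronSeveriGroup_iff Φ).2 ha) ((mem_neronSeveriGroup_iff Φ).2 hb'))
    · have hb0 : (b : ℝ) ≠ 0 := by exact_mod_cast hb.ne'
      have h := hab v
      have hform : ((a : ℝ) • L₁ - (b : ℝ) • L₂) ![I • v, v] =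
          (b : ℝ) * ((((a : ℝ) / b) • L₁ - L₂) ![I • v, v]) := by
        simp only [ContinuousAlternatingMap.sub_apply, ContinuousAlternatingMap.smul_apply, smul_eq_mul]
        field_simp
      rw [hform]
      exact mul_nonneg (Nat.cast_nonneg b) h
  have hPmem : sInf T • L₁ - L₂ ∈ Submodule.span ℝ≥0 G' := by
    have h : sInf T • L₁ - L₂ ∈ (Submodule.span ℝ≥0 G' : Set (E [⋀^Fin 2]→L[ℝ] ℝ)) :=
      hclosed.closure_eq ▸ hPcl
    exact h
  -- it is degenerate, hence `0`
  obtain ⟨w, hw, hw0⟩ := exists_ne_zero_and_apply_sInf_smul_sub_eq_zero h₁.1 h₁.2.2 h₂.1 h₂.2.2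
  have hP0 : sInf T • L₁ - L₂ = 0 :=
    hS.eq_zero_of_mem_span_nnreal_of_apply_I_smul_self_eq_zero Φ (fun η hη ↦ hG η (hG'G η hη)) hPmem hw hw0
  exact exists_rat_cast_smul_eq_of_smul_eq Φ h₁.isNSForm h₂.isNSForm (sub_eq_zero.1 hP0)

/-- **`NS(X) ⊗ ℚ = ℚ·[L]`**: under the hypotheses of the core (`X` simple, the semi-positive classes of
`NS(X)` in a finitely generated cone of such classes) every `η ∈ NS(X)` is a RATIONAL multiple of any given
polarisation `L` — `η = A₁ - A₂` is a difference of polarisations (file 49,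
`IsAbelianVariety.exists_isRiemannForm_sub_eq`), each proportional to `L`. [cite: Bauer1998ConeOfCurves, §2 Prop. 2.2] -/
theorem IsSimple.exists_eq_rat_cast_smul_of_forall_semipos_mem_span_nnreal (hS : IsSimple Φ)
    {G : Set (E [⋀^Fin 2]→L[ℝ] ℝ)} (hGfin : G.Finite)
    (hG : ∀ η ∈ G, IsNSForm Φ η ∧ ∀ v : E, 0 ≤ η ![I • v, v])
    (hgen : ∀ η : E [⋀^Fin 2]→L[ℝ] ℝ, IsNSForm Φ η → (∀ v : E, 0 ≤ η ![I • v, v]) →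
      η ∈ Submodule.span ℝ≥0 G)
    {L : E [⋀^Fin 2]→L[ℝ] ℝ} (hL : IsRiemannForm Φ L) {η : E [⋀^Fin 2]→L[ℝ] ℝ} (hη : IsNSForm Φ η) :
    ∃ q : ℚ, η = (q : ℝ) • L := by
  obtain ⟨A₁, A₂, hA₁, hA₂, rfl⟩ := IsAbelianVariety.exists_isRiemannForm_sub_eq Φ ⟨L, hL⟩ hη
  obtain ⟨q₁, hq₁⟩ := hS.exists_rat_cast_smul_eq_of_forall_semipos_mem_span_nnreal Φ hGfin hG hgen hL hA₁
  obtain ⟨q₂, hq₂⟩ := hS.exists_rat_cast_smul_eq_of_forall_semipos_mem_span_nnreal Φ hGfin hG hgen hL hA₂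
  refine ⟨q₁ - q₂, ?_⟩
  rw [← hq₁, ← hq₂]
  ext v
  simp only [ContinuousAlternatingMap.sub_apply, ContinuousAlternatingMap.smul_apply, smul_eq_mul, Rat.cast_sub]
  ring

omit [Fintype ι] [DecidableEq ι] in
/-- A polarisation of a non-zero torus has non-zero class `ofRealForm L ∈ H²(X, ℂ)`. [folklore] -/
private theorem ofRealForm_ne_zero_of_isRiemannForm [Nontrivial E] {L : E [⋀^Fin 2]→L[ℝ] ℝ}
    (hL : IsRiemannForm Φ L) : ofRealForm L ≠ 0 := by
  obtain ⟨v, hv⟩ := exists_ne (0 : E)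
  intro h
  have h' : L = 0 := ofRealForm_injective (by rw [h, ofRealForm_zero])
  have hpos := hL.2.2 v hv
  rw [h', ContinuousAlternatingMap.coe_zero, Pi.zero_apply] at hpos
  exact lt_irrefl _ hpos

/-- **`rk NS(X) = 1`** — the conclusion "`NS(X) ≅ ℤ`" of Prop. 2.2 as the Picard number
`ρ(X) = rk NS(X) = dim_ℚ H²_Hodge(X)` (file `ComplexTorusPicardNumber`): under the hypotheses of the core, for a
simple ABELIAN VARIETY `X ≠ 0`, `H²_Hodge(X) = ℚ · NS(X) = ℚ·[L]` is a line. [cite: Bauer1998ConeOfCurves, §2 Prop. 2.2]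
[cite: Lange2023AbelianVarietiesComplex, §1.3.1 Exercise 1.3.4 (10) (the Picard number)] -/
theorem IsSimple.finrank_neronSeveriGroup_eq_one_of_forall_semipos_mem_span_nnreal [Nontrivial E]
    (hS : IsSimple Φ) (hX : IsAbelianVariety Φ) {G : Set (E [⋀^Fin 2]→L[ℝ] ℝ)} (hGfin : G.Finite)
    (hG : ∀ η ∈ G, IsNSForm Φ η ∧ ∀ v : E, 0 ≤ η ![I • v, v])
    (hgen : ∀ η : E [⋀^Fin 2]→L[ℝ] ℝ, IsNSForm Φ η → (∀ v : E, 0 ≤ η ![I • v, v]) →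
      η ∈ Submodule.span ℝ≥0 G) :
    finrank ℤ (neronSeveriGroup Φ) = 1 := by
  obtain ⟨L, hL⟩ := hX
  rw [finrank_neronSeveriGroup_eq_finrank_hodgeClasses, hodgeClasses_one_eq_span_neronSeveri]
  have hspan : Submodule.span ℚ (ofRealForm '' (neronSeveriGroup Φ : Set (E [⋀^Fin 2]→L[ℝ] ℝ))) =
      Submodule.span ℚ {ofRealForm L} := by
    refine le_antisymm (Submodule.span_le.2 ?_) (Submodule.span_mono ?_)
    · rintro _ ⟨η, hη, rfl⟩
      obtain ⟨q, hq⟩ := hS.exists_eq_rat_cast_smul_of_forall_semipos_mem_span_nnreal Φ hGfin hG hgen hL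
        ((mem_neronSeveriGroup_iff Φ).1 hη)
      rw [hq, ofRealForm_smul, Complex.ofReal_ratCast, Rat.cast_smul_eq_qsmul]
      exact Submodule.smul_mem _ q (Submodule.subset_span rfl)
    · exact Set.singleton_subset_iff.2 ⟨L, mem_neronSeveriGroup_of_isRiemannForm Φ hL, rfl⟩
  rw [hspan, finrank_span_singleton (ofRealForm_ne_zero_of_isRiemannForm Φ hL)]

end Proportional

/-! ### §5 Prop. 2.2 as printed (`N(X)` finitely generated ⇒ `NS(X) ≅ ℤ`), the nef-cone form, and
Thm. 4.2 for `r = 1`: on a simple abelian variety, `N(X)` is finitely generated ⟺ `Nef(X)` is rational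
polyhedral ⟺ `rk NS(X) = 1` -/

section PropTwoTwo

variable {ι : Type*} [Fintype ι] [DecidableEq ι] {E : Type*} [NormedAddCommGroup E] [NormedSpace ℂ E]
  (Φ : (ι → ℝ) ≃L[ℝ] E)

/-- **Bauer 1998, Proposition 2.2, AS PRINTED: "Let `X` be a simple abelian variety such that `N(X)` is
finitely generated. Then `NS(X) ≅ ℤ`."** Here `N(X) = {η ∈ NS(X) | H_η ≥ 0}` is the semigroup of effective
(Lemma 2.1: = semi-positive = nef) classes, finite generation means `N(X) = AddSubmonoid.closure S` for a finite
`S`, and the conclusion is `rk NS(X) = 1` (`X ≠ 0`). [cite: Bauer1998ConeOfCurves, §2 Prop. 2.2] -/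
theorem IsSimple.finrank_neronSeveriGroup_eq_one_of_addSubmonoidClosure_eq [Nontrivial E] (hS : IsSimple Φ)
    (hX : IsAbelianVariety Φ) {S : Finset (E [⋀^Fin 2]→L[ℝ] ℝ)}
    (hgen : (AddSubmonoid.closure (S : Set (E [⋀^Fin 2]→L[ℝ] ℝ)) : Set (E [⋀^Fin 2]→L[ℝ] ℝ)) =
      {η | IsNSForm Φ η ∧ ∀ v : E, 0 ≤ η ![I • v, v]}) :
    finrank ℤ (neronSeveriGroup Φ) = 1 := by
  refine hS.finrank_neronSeveriGroup_eq_one_of_forall_semipos_mem_span_nnreal Φ hX S.finite_toSet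
    (fun η hη ↦ ?_) fun η hη hpsd ↦ ?_
  · have h : η ∈ (AddSubmonoid.closure (S : Set (E [⋀^Fin 2]→L[ℝ] ℝ)) : Set (E [⋀^Fin 2]→L[ℝ] ℝ)) :=
      AddSubmonoid.subset_closure hη
    rw [hgen] at h
    exact h
  · have h : η ∈ (AddSubmonoid.closure (S : Set (E [⋀^Fin 2]→L[ℝ] ℝ)) : Set (E [⋀^Fin 2]→L[ℝ] ℝ)) := by
      rw [hgen]
      exact ⟨hη, hpsd⟩
    exact (AddSubmonoid.closure_le.2 (show (S : Set (E [⋀^Fin 2]→L[ℝ] ℝ)) ⊆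
      ((Submodule.span ℝ≥0 (S : Set (E [⋀^Fin 2]→L[ℝ] ℝ))).toAddSubmonoid : Set (E [⋀^Fin 2]→L[ℝ] ℝ))
      from Submodule.subset_span)) h

/-- **The Theorem, (ib) ⇒ (ii), for a simple abelian variety: if the nef cone
`Nef(X) = {θ ∈ NS_ℝ(X) | H_θ ≥ 0}` (file 49: = the nef classes of `NS_ℝ(X) = span_ℝ NS(X)`) is a RATIONAL
POLYHEDRAL cone — the convex cone `Σᵢ ℝ≥0·Nᵢ` of finitely many integral classes `Nᵢ ∈ NS(X)` — then
`rk NS(X) = 1`.** [cite: Bauer1998ConeOfCurves, §1 Theorem ((ib) ⇒ (ii)) and §2 Prop. 2.2] -/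
theorem IsSimple.finrank_neronSeveriGroup_eq_one_of_span_nnreal_eq [Nontrivial E] (hS : IsSimple Φ)
    (hX : IsAbelianVariety Φ) {S : Finset (E [⋀^Fin 2]→L[ℝ] ℝ)} (hS' : ∀ η ∈ S, IsNSForm Φ η)
    (hnef : (Submodule.span ℝ≥0 (S : Set (E [⋀^Fin 2]→L[ℝ] ℝ)) : Set (E [⋀^Fin 2]→L[ℝ] ℝ)) =
      {θ | θ ∈ Submodule.span ℝ {η : E [⋀^Fin 2]→L[ℝ] ℝ | IsNSForm Φ η} ∧ ∀ v : E, 0 ≤ θ ![I • v, v]}) :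
    finrank ℤ (neronSeveriGroup Φ) = 1 := by
  refine hS.finrank_neronSeveriGroup_eq_one_of_forall_semipos_mem_span_nnreal Φ hX S.finite_toSet
    (fun η hη ↦ ⟨hS' η hη, ?_⟩) fun η hη hpsd ↦ ?_
  · have h : η ∈ (Submodule.span ℝ≥0 (S : Set (E [⋀^Fin 2]→L[ℝ] ℝ)) : Set (E [⋀^Fin 2]→L[ℝ] ℝ)) :=
      Submodule.subset_span hη
    rw [hnef] at h
    exact h.2
  · have h : η ∈ (Submodule.span ℝ≥0 (S : Set (E [⋀^Fin 2]→L[ℝ] ℝ)) : Set (E [⋀^Fin 2]→L[ℝ] ℝ)) := by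
      rw [hnef]
      exact ⟨Submodule.subset_span hη, hpsd⟩
    exact h

omit [DecidableEq ι] in
/-- **`rk NS(X) = 1` ⇒ `NS(X) = ℤ·[M]` for a polarisation `M`** (on an abelian variety `X ≠ 0`): `NS(X)` is
free (file `ComplexTorusPicardNumber`), so of the form `ℤ·M₀`; a polarisation `A = kM₀` has `k ≠ 0`, and
`M = sign(k) M₀ = |k|⁻¹ A` is a polarisation generating `NS(X)`. (The ample generator "`Nᵢ` of `Pic(Xᵢ)`" of
Bauer's proof of Thm. 4.2.) [cite: Bauer1998ConeOfCurves, §4 Thm. 4.2 (proof: "Fix … an ample generator `Nᵢ`")]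
[cite: Lange2023AbelianVarietiesComplex, §1.3.1 Exercise 1.3.4 (10)] -/
theorem exists_isRiemannForm_forall_eq_int_cast_smul_of_finrank_eq_one [Nontrivial E] (hX : IsAbelianVariety Φ)
    (h1 : finrank ℤ (neronSeveriGroup Φ) = 1) :
    ∃ M : E [⋀^Fin 2]→L[ℝ] ℝ, IsRiemannForm Φ M ∧
      ∀ η : E [⋀^Fin 2]→L[ℝ] ℝ, IsNSForm Φ η → ∃ n : ℤ, η = (n : ℝ) • M := by
  haveI := moduleFree_neronSeveriGroup Φ
  haveI := moduleFinite_neronSeveriGroup Φ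
  let b := Module.finBasisOfFinrankEq ℤ (neronSeveriGroup Φ) h1
  set M₀ : E [⋀^Fin 2]→L[ℝ] ℝ := ((b 0 : neronSeveriGroup Φ) : E [⋀^Fin 2]→L[ℝ] ℝ) with hM₀
  have hM₀NS : IsNSForm Φ M₀ := (b 0).2
  -- every class is an integer multiple of `M₀`
  have hrepr : ∀ (η : E [⋀^Fin 2]→L[ℝ] ℝ) (hη : IsNSForm Φ η), η = ((b.repr ⟨η, hη⟩ 0 : ℤ) : ℝ) • M₀ := by
    intro η hη
    have h := b.sum_repr ⟨η, hη⟩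
    rw [Fin.sum_univ_one] at h
    have h' := congrArg (fun x : neronSeveriGroup Φ ↦ (x : E [⋀^Fin 2]→L[ℝ] ℝ)) h
    simp only [AddSubgroup.coe_zsmul] at h'
    rw [← Int.cast_smul_eq_zsmul ℝ] at h'
    exact h'.symm
  obtain ⟨A, hA⟩ := hX
  set k : ℤ := b.repr ⟨A, hA.isNSForm⟩ 0 with hk
  have hAk : A = (k : ℝ) • M₀ := hrepr A hA.isNSForm
  obtain ⟨v₀, hv₀⟩ := exists_ne (0 : E)
  have hk0 : k ≠ 0 := by
    intro h0
    have hpos := hA.2.2 v₀ hv₀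
    rw [hAk, h0, Int.cast_zero, zero_smul, ContinuousAlternatingMap.coe_zero, Pi.zero_apply] at hpos
    exact lt_irrefl _ hpos
  have hk0' : (k : ℝ) ≠ 0 := by exact_mod_cast hk0
  -- `M = σ M₀` with `σ = sign k`
  obtain ⟨σ, hσ1, hσk⟩ : ∃ σ : ℤ, σ * σ = 1 ∧ 0 < σ * k := by
    rcases lt_or_gt_of_ne hk0 with h | h
    · exact ⟨-1, by norm_num, by linarith⟩
    · exact ⟨1, by norm_num, by linarith⟩
  have hσ1' : (σ : ℝ) * σ = 1 := by exact_mod_cast hσ1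
  have hσk' : (0 : ℝ) < σ * k := by exact_mod_cast hσk
  set M : E [⋀^Fin 2]→L[ℝ] ℝ := (σ : ℝ) • M₀ with hM
  have hMNS : IsNSForm Φ M := by
    have h := AddSubgroup.zsmul_mem _ ((mem_neronSeveriGroup_iff Φ).2 hM₀NS) σ
    rw [← Int.cast_smul_eq_zsmul ℝ] at h
    exact (mem_neronSeveriGroup_iff Φ).1 h
  have hMpos : ∀ v : E, v ≠ 0 → 0 < M ![I • v, v] := by
    intro v hv
    have hApos := hA.2.2 v hv
    rw [hAk, ContinuousAlternatingMap.smul_apply, smul_eq_mul] at hApos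
    rw [hM, ContinuousAlternatingMap.smul_apply, smul_eq_mul]
    have hk2 : (0 : ℝ) < (k : ℝ) ^ 2 := by positivity
    have h3 : 0 < (k : ℝ) ^ 2 * ((σ : ℝ) * M₀ ![I • v, v]) := by
      have h := mul_pos hσk' hApos
      have hcalc : (σ : ℝ) * k * ((k : ℝ) * M₀ ![I • v, v]) = (k : ℝ) ^ 2 * ((σ : ℝ) * M₀ ![I • v, v]) := by
        ring
      rwa [hcalc] at h
    exact (mul_pos_iff_of_pos_left hk2).1 h3
  refine ⟨M, ⟨hMNS.type_one_one, hMNS.integral, hMpos⟩, fun η hη ↦ ⟨b.repr ⟨η, hη⟩ 0 * σ, ?_⟩⟩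
  rw [hM, Int.cast_mul, smul_smul, mul_assoc, hσ1', mul_one]
  exact hrepr η hη

omit [DecidableEq ι] in
/-- **Thm. 4.2, "if" half, for `r = 1`: `NS(X) ≅ ℤ` ⇒ `N(X) = ℤ⁺·[M]` is finitely generated** ("Fix … an ample
generator `Nᵢ` of `Pic(Xᵢ)` … Therefore `N(X) = ⊕ᵢ ℤ⁺·[Nᵢ]` is finitely generated"): on an abelian variety
`X ≠ 0` of Picard number `1` the semigroup of semi-positive (= effective) classes is generated by ONE
polarisation `M` — a class `nM`, `n ∈ ℤ`, is semi-positive iff `n ≥ 0`. [cite: Bauer1998ConeOfCurves, §4 Thm. 4.2 (proof, "if" half)] -/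
theorem exists_addSubmonoidClosure_singleton_eq_of_finrank_eq_one [Nontrivial E] (hX : IsAbelianVariety Φ)
    (h1 : finrank ℤ (neronSeveriGroup Φ) = 1) :
    ∃ M : E [⋀^Fin 2]→L[ℝ] ℝ, IsRiemannForm Φ M ∧
      (AddSubmonoid.closure ({M} : Set (E [⋀^Fin 2]→L[ℝ] ℝ)) : Set (E [⋀^Fin 2]→L[ℝ] ℝ)) =
        {η | IsNSForm Φ η ∧ ∀ v : E, 0 ≤ η ![I • v, v]} := by
  obtain ⟨M, hM, hgen⟩ := exists_isRiemannForm_forall_eq_int_cast_smul_of_finrank_eq_one Φ hX h1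
  refine ⟨M, hM, Set.ext fun η ↦ ⟨fun hη ↦ ?_, fun hη ↦ ?_⟩⟩
  · obtain ⟨n, rfl⟩ := AddSubmonoid.mem_closure_singleton.1 hη
    refine ⟨(mem_neronSeveriGroup_iff Φ).1
      (AddSubgroup.nsmul_mem _ (mem_neronSeveriGroup_of_isRiemannForm Φ hM) n), fun v ↦ ?_⟩
    rw [← Nat.cast_smul_eq_nsmul ℝ, ContinuousAlternatingMap.smul_apply, smul_eq_mul]
    exact mul_nonneg n.cast_nonneg (apply_I_smul_self_nonneg_of_pos hM.2.2 v)
  · obtain ⟨n, hn⟩ := hgen η hη.1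
    obtain ⟨v₀, hv₀⟩ := exists_ne (0 : E)
    have hn0 : 0 ≤ n := by
      have h := hη.2 v₀
      rw [hn, ContinuousAlternatingMap.smul_apply, smul_eq_mul] at h
      have hMpos := hM.2.2 v₀ hv₀
      by_contra hneg
      push Not at hneg
      have hneg' : (n : ℝ) < 0 := by exact_mod_cast hneg
      nlinarith
    refine AddSubmonoid.mem_closure_singleton.2 ⟨n.toNat, ?_⟩
    rw [hn, ← Nat.cast_smul_eq_nsmul ℝ]
    congr 1
    have h : ((n.toNat : ℤ) : ℝ) = (n : ℝ) := by rw [Int.toNat_of_nonneg hn0]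
    exact_mod_cast h

omit [DecidableEq ι] in
/-- **Thm. 4.2, "if" half, for `r = 1`, nef-cone form: `NS(X) ≅ ℤ` ⇒ `Nef(X) = ℝ≥0·[M]` is a rational
polyhedral cone** — on an abelian variety `X ≠ 0` of Picard number `1`, `NS_ℝ(X) = ℝ·M` for a polarisation
`M` and the semi-positive (= nef, file 49) real classes are the ray `ℝ≥0·M`. [cite: Bauer1998ConeOfCurves, §4 Thm. 4.2 (proof, "if" half) and §1 Theorem ((ii) ⇒ (ib))] -/
theorem exists_span_nnreal_singleton_eq_of_finrank_eq_one [Nontrivial E] (hX : IsAbelianVariety Φ)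
    (h1 : finrank ℤ (neronSeveriGroup Φ) = 1) :
    ∃ M : E [⋀^Fin 2]→L[ℝ] ℝ, IsRiemannForm Φ M ∧
      (Submodule.span ℝ≥0 ({M} : Set (E [⋀^Fin 2]→L[ℝ] ℝ)) : Set (E [⋀^Fin 2]→L[ℝ] ℝ)) =
        {θ | θ ∈ Submodule.span ℝ {η : E [⋀^Fin 2]→L[ℝ] ℝ | IsNSForm Φ η} ∧ ∀ v : E, 0 ≤ θ ![I • v, v]} := by
  obtain ⟨M, hM, hgen⟩ := exists_isRiemannForm_forall_eq_int_cast_smul_of_finrank_eq_one Φ hX h1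
  refine ⟨M, hM, Set.ext fun θ ↦ ⟨fun hθ ↦ ?_, fun hθ ↦ ?_⟩⟩
  · obtain ⟨c, rfl⟩ := Submodule.mem_span_singleton.1 hθ
    refine ⟨?_, fun v ↦ ?_⟩
    · rw [NNReal.smul_def]
      exact Submodule.smul_mem _ _ (Submodule.subset_span hM.isNSForm)
    · rw [NNReal.smul_def, ContinuousAlternatingMap.smul_apply, smul_eq_mul]
      exact mul_nonneg c.2 (apply_I_smul_self_nonneg_of_pos hM.2.2 v)
  · obtain ⟨hθ1, hθ2⟩ := hθ
    have hθM : ∃ c : ℝ, θ = c • M := by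
      clear hθ2
      induction hθ1 using Submodule.span_induction with
      | mem η hη =>
        obtain ⟨n, hn⟩ := hgen η hη
        exact ⟨n, hn⟩
      | zero => exact ⟨0, by rw [zero_smul]⟩
      | add x y _ _ ihx ihy =>
        obtain ⟨c₁, rfl⟩ := ihx
        obtain ⟨c₂, rfl⟩ := ihy
        refine ⟨c₁ + c₂, ?_⟩
        ext v
        simp only [ContinuousAlternatingMap.add_apply, ContinuousAlternatingMap.smul_apply, smul_eq_mul]
        ring
      | smul r x _ ih =>
        obtain ⟨c, rfl⟩ := ih
        exact ⟨r * c, by rw [smul_smul]⟩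
    obtain ⟨c, rfl⟩ := hθM
    obtain ⟨v₀, hv₀⟩ := exists_ne (0 : E)
    have hc : 0 ≤ c := by
      have h := hθ2 v₀
      rw [ContinuousAlternatingMap.smul_apply, smul_eq_mul] at h
      have hMpos := hM.2.2 v₀ hv₀
      by_contra hneg
      push Not at hneg
      nlinarith
    exact smul_mem_span_nnreal_of_nonneg hc (Submodule.subset_span rfl)

/-- **THE THEOREM, (ic) ⟺ (ii), for a simple abelian variety `X ≠ 0`: the semigroup `N(X)` of effective
(= semi-positive) classes is finitely generated if and only if `NS(X) ≅ ℤ`** (Prop. 2.2 and Thm. 4.2 with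
`r = 1`). [cite: Bauer1998ConeOfCurves, §1 Theorem ((ic) ⟺ (ii)), §2 Prop. 2.2, §4 Thm. 4.2] -/
theorem IsSimple.exists_addSubmonoidClosure_eq_iff_finrank_eq_one [Nontrivial E] (hS : IsSimple Φ)
    (hX : IsAbelianVariety Φ) :
    (∃ S : Finset (E [⋀^Fin 2]→L[ℝ] ℝ),
        (AddSubmonoid.closure (S : Set (E [⋀^Fin 2]→L[ℝ] ℝ)) : Set (E [⋀^Fin 2]→L[ℝ] ℝ)) =
          {η | IsNSForm Φ η ∧ ∀ v : E, 0 ≤ η ![I • v, v]}) ↔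
      finrank ℤ (neronSeveriGroup Φ) = 1 := by
  refine ⟨fun ⟨S, hS'⟩ ↦ hS.finrank_neronSeveriGroup_eq_one_of_addSubmonoidClosure_eq Φ hX hS', fun h1 ↦ ?_⟩
  obtain ⟨M, -, hM⟩ := exists_addSubmonoidClosure_singleton_eq_of_finrank_eq_one Φ hX h1
  refine ⟨{M}, ?_⟩
  rw [Finset.coe_singleton]
  exact hM

/-- **THE THEOREM, (ib) ⟺ (ii), for a simple abelian variety `X ≠ 0`: the nef cone
`Nef(X) = {θ ∈ NS_ℝ(X) | H_θ ≥ 0}` is a rational polyhedral cone (spanned over `ℝ≥0` by finitely many integral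
classes) if and only if `NS(X) ≅ ℤ`.** [cite: Bauer1998ConeOfCurves, §1 Theorem ((ib) ⟺ (ii)), §2 Prop. 2.2, §4 Thm. 4.2] -/
theorem IsSimple.exists_span_nnreal_eq_iff_finrank_eq_one [Nontrivial E] (hS : IsSimple Φ)
    (hX : IsAbelianVariety Φ) :
    (∃ S : Finset (E [⋀^Fin 2]→L[ℝ] ℝ), (∀ η ∈ S, IsNSForm Φ η) ∧
        (Submodule.span ℝ≥0 (S : Set (E [⋀^Fin 2]→L[ℝ] ℝ)) : Set (E [⋀^Fin 2]→L[ℝ] ℝ)) =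
          {θ | θ ∈ Submodule.span ℝ {η : E [⋀^Fin 2]→L[ℝ] ℝ | IsNSForm Φ η} ∧ ∀ v : E, 0 ≤ θ ![I • v, v]}) ↔
      finrank ℤ (neronSeveriGroup Φ) = 1 := by
  refine ⟨fun ⟨S, hSNS, hS'⟩ ↦ hS.finrank_neronSeveriGroup_eq_one_of_span_nnreal_eq Φ hX hSNS hS', fun h1 ↦ ?_⟩
  obtain ⟨M, hM, hM'⟩ := exists_span_nnreal_singleton_eq_of_finrank_eq_one Φ hX h1
  refine ⟨{M}, fun η hη ↦ ?_, ?_⟩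
  · rw [Finset.mem_singleton] at hη
    rw [hη]
    exact hM.isNSForm
  · rw [Finset.coe_singleton]
    exact hM'

end PropTwoTwo

/-! ### §6 The same statements with `N(X)` the set of EFFECTIVE classes `c₁ = Σᵢ [Yᵢ]_e`, and with the nef
cone defined by degrees on curves -/

section Effective

variable {ι : Type*} [Fintype ι] [DecidableEq ι] {E : Type u} [NormedAddCommGroup E] [InnerProductSpace ℂ E]
  [FiniteDimensional ℂ E] [MeasurableSpace E] [BorelSpace E] (Φ : (ι → ℝ) ≃L[ℝ] E)

/-- **`N(X)` as printed is the set of semi-positive classes**: the classes `η` with `ofRealForm(-η) = Σᵢ [Yᵢ]_e`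
an effective divisor class (hypersurfaces `Yᵢ`, `e` positively oriented; Bauer's "`λ = c₁(L)` for some
`L ∈ Pic(X)` with `h⁰(X, L) > 0`", up to algebraic equivalence = Lemma 2.1 (i)) are exactly the `η ∈ NS(X)`
with `H_η ≥ 0` — the tree's `semipos_iff_exists_sum_analyticCycleClass_eq` (Lange Thm. 1.5.11), as an equality
of sets. [cite: Bauer1998ConeOfCurves, §1 (the semi-group `N(X)`) and §2 Lemma 2.1 ((i))]
[cite: Lange2023AbelianVarietiesComplex, §1.5.4 Thm. 1.5.11] -/
theorem setOf_exists_sum_analyticCycleClass_eq {n d : ℕ} (e : Fin n ≃ ι) (h : 2 * d + 2 = n)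
    (he : orientationSign Φ e = 1) :
    {η : E [⋀^Fin 2]→L[ℝ] ℝ | ∃ (k : ℕ) (Y : Fin k → {Z : Set (ComplexTorus Φ) // HasPureDim 𝓘(ℂ, E) Z d}),
        ofRealForm (-η) = ∑ i, analyticCycleClass Φ e h (Y i).2} =
      {η | IsNSForm Φ η ∧ ∀ v : E, 0 ≤ η ![I • v, v]} :=
  Set.ext fun η ↦ (semipos_iff_exists_sum_analyticCycleClass_eq Φ e h he η).symm

/-- **On an abelian variety `N(X)` is also the set of NEF classes** `{η ∈ NS(X) | (L_η · C) ≥ 0 for every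
irreducible curve C}` (Lemma 2.1 (i) ⟺ (ii); file 48 `IsAbelianVariety.semipos_iff_forall_curve`), as an
equality of sets. [cite: Bauer1998ConeOfCurves, §2 Lemma 2.1 ((i) ⟺ (ii))] -/
theorem IsAbelianVariety.setOf_forall_curve_nonneg_eq (hX : IsAbelianVariety Φ) {g : ℕ} (e : Fin (2 * g) ≃ ι) :
    {η : E [⋀^Fin 2]→L[ℝ] ℝ | IsNSForm Φ η ∧
        ∀ (C : Set (ComplexTorus Φ)) (hC : HasPureDim 𝓘(ℂ, E) C 1), IsIrreducibleAnalyticSet 𝓘(ℂ, E) C →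
          0 ≤ (analyticCyclePeriod Φ hC (ofRealForm (-η))).re} =
      {η | IsNSForm Φ η ∧ ∀ v : E, 0 ≤ η ![I • v, v]} :=
  Set.ext fun _ ↦ ⟨fun hη ↦ ⟨hη.1, (hX.semipos_iff_forall_curve Φ e hη.1).2 hη.2⟩,
    fun hη ↦ ⟨hη.1, (hX.semipos_iff_forall_curve Φ e hη.1).1 hη.2⟩⟩

/-- **The nef cone of `NS_ℝ(X)` defined by degrees on curves is the semi-positive cone** (file 49,
`IsAbelianVariety.semipos_iff_forall_curve_of_mem_span`), as an equality of sets. [cite: Bauer1998ConeOfCurves, §4 (the nef cone)] -/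
theorem IsAbelianVariety.setOf_mem_span_forall_curve_nonneg_eq (hX : IsAbelianVariety Φ) {g : ℕ}
    (e : Fin (2 * g) ≃ ι) :
    {θ : E [⋀^Fin 2]→L[ℝ] ℝ | θ ∈ Submodule.span ℝ {η : E [⋀^Fin 2]→L[ℝ] ℝ | IsNSForm Φ η} ∧
        ∀ (C : Set (ComplexTorus Φ)) (hC : HasPureDim 𝓘(ℂ, E) C 1), IsIrreducibleAnalyticSet 𝓘(ℂ, E) C →
          0 ≤ (analyticCyclePeriod Φ hC (ofRealForm (-θ))).re} =
      {θ | θ ∈ Submodule.span ℝ {η : E [⋀^Fin 2]→L[ℝ] ℝ | IsNSForm Φ η} ∧ ∀ v : E, 0 ≤ θ ![I • v, v]} :=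
  Set.ext fun _ ↦ ⟨fun hθ ↦ ⟨hθ.1, (hX.semipos_iff_forall_curve_of_mem_span Φ e hθ.1).2 hθ.2⟩,
    fun hθ ↦ ⟨hθ.1, (hX.semipos_iff_forall_curve_of_mem_span Φ e hθ.1).1 hθ.2⟩⟩

/-- **Prop. 2.2 with `N(X)` the semigroup of effective classes, verbatim**: on a simple abelian variety `X ≠ 0`
(of dimension `d + 1`, `e` a positively oriented lattice enumeration), if the classes `η` with
`ofRealForm(-η) = Σᵢ [Yᵢ]_e` form a finitely generated additive monoid, then `rk NS(X) = 1`.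
[cite: Bauer1998ConeOfCurves, §2 Prop. 2.2] -/
theorem IsSimple.finrank_neronSeveriGroup_eq_one_of_addSubmonoidClosure_eq_effective [Nontrivial E]
    (hS : IsSimple Φ) (hX : IsAbelianVariety Φ) {n d : ℕ} (e : Fin n ≃ ι) (h : 2 * d + 2 = n)
    (he : orientationSign Φ e = 1) {S : Finset (E [⋀^Fin 2]→L[ℝ] ℝ)}
    (hgen : (AddSubmonoid.closure (S : Set (E [⋀^Fin 2]→L[ℝ] ℝ)) : Set (E [⋀^Fin 2]→L[ℝ] ℝ)) =
      {η : E [⋀^Fin 2]→L[ℝ] ℝ | ∃ (k : ℕ) (Y : Fin k → {Z : Set (ComplexTorus Φ) // HasPureDim 𝓘(ℂ, E) Z d}),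
        ofRealForm (-η) = ∑ i, analyticCycleClass Φ e h (Y i).2}) :
    finrank ℤ (neronSeveriGroup Φ) = 1 := by
  rw [setOf_exists_sum_analyticCycleClass_eq Φ e h he] at hgen
  exact hS.finrank_neronSeveriGroup_eq_one_of_addSubmonoidClosure_eq Φ hX hgen

/-- **Prop. 2.2 with `N(X)` the semigroup of nef line bundles**: on a simple abelian variety `X ≠ 0`, if the
classes `η ∈ NS(X)` with `(L_η · C) = Re ∫_C ofRealForm(-η) ≥ 0` for every irreducible curve `C` form a
finitely generated additive monoid, then `rk NS(X) = 1`. [cite: Bauer1998ConeOfCurves, §2 Prop. 2.2 and Lemma 2.1] -/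
theorem IsSimple.finrank_neronSeveriGroup_eq_one_of_addSubmonoidClosure_eq_nef [Nontrivial E]
    (hS : IsSimple Φ) (hX : IsAbelianVariety Φ) {g : ℕ} (e : Fin (2 * g) ≃ ι) {S : Finset (E [⋀^Fin 2]→L[ℝ] ℝ)}
    (hgen : (AddSubmonoid.closure (S : Set (E [⋀^Fin 2]→L[ℝ] ℝ)) : Set (E [⋀^Fin 2]→L[ℝ] ℝ)) =
      {η : E [⋀^Fin 2]→L[ℝ] ℝ | IsNSForm Φ η ∧
        ∀ (C : Set (ComplexTorus Φ)) (hC : HasPureDim 𝓘(ℂ, E) C 1), IsIrreducibleAnalyticSet 𝓘(ℂ, E) C →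
          0 ≤ (analyticCyclePeriod Φ hC (ofRealForm (-η))).re}) :
    finrank ℤ (neronSeveriGroup Φ) = 1 := by
  rw [hX.setOf_forall_curve_nonneg_eq Φ e] at hgen
  exact hS.finrank_neronSeveriGroup_eq_one_of_addSubmonoidClosure_eq Φ hX hgen

/-- **The Theorem, (ib) ⇒ (ii), with the nef cone defined by curves**: on a simple abelian variety `X ≠ 0`, if
`Nef(X) = {θ ∈ NS_ℝ(X) | Re ∫_C ofRealForm(-θ) ≥ 0 for all irreducible curves C}` is the `ℝ≥0`-span of finitely
many integral classes, then `rk NS(X) = 1`. [cite: Bauer1998ConeOfCurves, §1 Theorem ((ib) ⇒ (ii)) and §4 (the nef cone)] -/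
theorem IsSimple.finrank_neronSeveriGroup_eq_one_of_span_nnreal_eq_nef [Nontrivial E] (hS : IsSimple Φ)
    (hX : IsAbelianVariety Φ) {g : ℕ} (e : Fin (2 * g) ≃ ι) {S : Finset (E [⋀^Fin 2]→L[ℝ] ℝ)}
    (hS' : ∀ η ∈ S, IsNSForm Φ η)
    (hnef : (Submodule.span ℝ≥0 (S : Set (E [⋀^Fin 2]→L[ℝ] ℝ)) : Set (E [⋀^Fin 2]→L[ℝ] ℝ)) =
      {θ : E [⋀^Fin 2]→L[ℝ] ℝ | θ ∈ Submodule.span ℝ {η : E [⋀^Fin 2]→L[ℝ] ℝ | IsNSForm Φ η} ∧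
        ∀ (C : Set (ComplexTorus Φ)) (hC : HasPureDim 𝓘(ℂ, E) C 1), IsIrreducibleAnalyticSet 𝓘(ℂ, E) C →
          0 ≤ (analyticCyclePeriod Φ hC (ofRealForm (-θ))).re}) :
    finrank ℤ (neronSeveriGroup Φ) = 1 := by
  rw [hX.setOf_mem_span_forall_curve_nonneg_eq Φ e] at hnef
  exact hS.finrank_neronSeveriGroup_eq_one_of_span_nnreal_eq Φ hX hS' hnef

/-- **THE THEOREM, (ic) ⟺ (ii), effective-classes form, for a simple abelian variety `X ≠ 0`**: the
semigroup `N(X) = {η | ofRealForm(-η) = Σᵢ [Yᵢ]_e}` of effective divisor classes is finitely generated iff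
`NS(X) ≅ ℤ`. [cite: Bauer1998ConeOfCurves, §1 Theorem ((ic) ⟺ (ii)), §2 Prop. 2.2, §4 Thm. 4.2] -/
theorem IsSimple.exists_addSubmonoidClosure_eq_effective_iff_finrank_eq_one [Nontrivial E] (hS : IsSimple Φ)
    (hX : IsAbelianVariety Φ) {n d : ℕ} (e : Fin n ≃ ι) (h : 2 * d + 2 = n) (he : orientationSign Φ e = 1) :
    (∃ S : Finset (E [⋀^Fin 2]→L[ℝ] ℝ),
        (AddSubmonoid.closure (S : Set (E [⋀^Fin 2]→L[ℝ] ℝ)) : Set (E [⋀^Fin 2]→L[ℝ] ℝ)) =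
          {η : E [⋀^Fin 2]→L[ℝ] ℝ | ∃ (k : ℕ) (Y : Fin k → {Z : Set (ComplexTorus Φ) // HasPureDim 𝓘(ℂ, E) Z d}),
            ofRealForm (-η) = ∑ i, analyticCycleClass Φ e h (Y i).2}) ↔
      finrank ℤ (neronSeveriGroup Φ) = 1 := by
  rw [setOf_exists_sum_analyticCycleClass_eq Φ e h he]
  exact hS.exists_addSubmonoidClosure_eq_iff_finrank_eq_one Φ hX

end Effective

/-! ### §7 (appended, generation 44 row g44-#2) Rational generators: `Nef(X)` spanned over `ℝ≥0` by finitely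
many classes of `NS_ℚ(X) = NS(X) ⊗ ℚ`; rational boundary classes of the nef cone of a simple abelian variety -/

section Rational

variable {ι : Type*} [Fintype ι] [DecidableEq ι] {E : Type*} [NormedAddCommGroup E] [NormedSpace ℂ E]
  (Φ : (ι → ℝ) ≃L[ℝ] E)

omit [Fintype ι] [DecidableEq ι] in
/-- An integer multiple of a Néron–Severi class is a Néron–Severi class. [cite: Lange2023AbelianVarietiesComplex, §1.3.1 (the group `NS(X)`)] -/
private theorem isNSForm_int_cast_smul {η : E [⋀^Fin 2]→L[ℝ] ℝ} (hη : IsNSForm Φ η) (k : ℤ) :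
    IsNSForm Φ ((k : ℝ) • η) := by
  have h := AddSubgroup.zsmul_mem _ ((mem_neronSeveriGroup_iff Φ).2 hη) k
  rw [← Int.cast_smul_eq_zsmul ℝ] at h
  exact (mem_neronSeveriGroup_iff Φ).1 h

omit [Fintype ι] [DecidableEq ι] in
/-- **Every class of `NS_ℚ(X) = NS(X) ⊗ ℚ` has a positive integer multiple in `NS(X)`** (clearing
denominators: `NS_ℚ(X)` is the `ℚ`-span of `NS(X)` inside the real `2`-forms). [cite: Bauer1998ConeOfCurves, §2 Prop. 2.2 (proof: "We choose an integer `n` such that `ns ∈ ℤ`. The line bundle `nL` is then … integral")] -/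
theorem exists_pos_isNSForm_nat_cast_smul_of_mem_span_rat {θ : E [⋀^Fin 2]→L[ℝ] ℝ}
    (hθ : θ ∈ Submodule.span ℚ {η : E [⋀^Fin 2]→L[ℝ] ℝ | IsNSForm Φ η}) :
    ∃ n : ℕ, 0 < n ∧ IsNSForm Φ ((n : ℝ) • θ) := by
  induction hθ using Submodule.span_induction with
  | mem η hη => exact ⟨1, one_pos, by rw [Nat.cast_one, one_smul]; exact hη⟩
  | zero => exact ⟨1, one_pos, by rw [smul_zero]; exact (neronSeveriGroup Φ).zero_mem⟩
  | add x y _ _ ihx ihy =>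
    obtain ⟨n₁, hn₁, hx⟩ := ihx
    obtain ⟨n₂, hn₂, hy⟩ := ihy
    refine ⟨n₁ * n₂, mul_pos hn₁ hn₂, ?_⟩
    have hform : ((n₁ * n₂ : ℕ) : ℝ) • (x + y) = ((n₂ : ℤ) : ℝ) • ((n₁ : ℝ) • x) + ((n₁ : ℤ) : ℝ) • ((n₂ : ℝ) • y) := by
      ext v
      simp only [ContinuousAlternatingMap.add_apply, ContinuousAlternatingMap.smul_apply, smul_eq_mul]
      push_cast
      ring
    rw [hform]
    exact (isNSForm_int_cast_smul Φ hx n₂).add (isNSForm_int_cast_smul Φ hy n₁)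
  | smul q x _ ih =>
    obtain ⟨n, hn, hx⟩ := ih
    refine ⟨q.den * n, mul_pos q.den_pos hn, ?_⟩
    have hform : ((q.den * n : ℕ) : ℝ) • (q • x) = ((q.num : ℤ) : ℝ) • ((n : ℝ) • x) := by
      rw [← Rat.cast_smul_eq_qsmul ℝ q x]
      ext v
      simp only [ContinuousAlternatingMap.smul_apply, smul_eq_mul]
      have hq : (q : ℝ) * q.den = q.num := by exact_mod_cast Rat.mul_den_eq_num q
      push_cast
      rw [← hq]
      ring
    rw [hform]
    exact isNSForm_int_cast_smul Φ hx q.num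

/-- **The Theorem, (ib) ⇒ (ii), with RATIONAL generators**: on a simple abelian variety `X ≠ 0`, if the nef
cone `Nef(X) = {θ ∈ NS_ℝ(X) | H_θ ≥ 0}` is the convex cone `Σᵢ ℝ≥0·Nᵢ` of finitely many classes
`Nᵢ ∈ NS_ℚ(X) = NS(X) ⊗ ℚ` ("rational polyhedral"), then `rk NS(X) = 1` — clear denominators (`nᵢNᵢ ∈ NS(X)`,
positive rescaling of generators does not change the cone) and apply §4. [cite: Bauer1998ConeOfCurves, §1 Theorem ((ib) ⇒ (ii)) and §2 Prop. 2.2] -/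
theorem IsSimple.finrank_neronSeveriGroup_eq_one_of_span_nnreal_eq_of_subset_span_rat [Nontrivial E]
    (hS : IsSimple Φ) (hX : IsAbelianVariety Φ) {S : Finset (E [⋀^Fin 2]→L[ℝ] ℝ)}
    (hS' : ∀ η ∈ S, η ∈ Submodule.span ℚ {η : E [⋀^Fin 2]→L[ℝ] ℝ | IsNSForm Φ η})
    (hnef : (Submodule.span ℝ≥0 (S : Set (E [⋀^Fin 2]→L[ℝ] ℝ)) : Set (E [⋀^Fin 2]→L[ℝ] ℝ)) =
      {θ | θ ∈ Submodule.span ℝ {η : E [⋀^Fin 2]→L[ℝ] ℝ | IsNSForm Φ η} ∧ ∀ v : E, 0 ≤ θ ![I • v, v]}) :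
    finrank ℤ (neronSeveriGroup Φ) = 1 := by
  classical
  -- clear denominators: `G = {n_η η | η ∈ S}`
  have hch : ∀ η : E [⋀^Fin 2]→L[ℝ] ℝ, ∃ n : ℕ, η ∈ S → 0 < n ∧ IsNSForm Φ ((n : ℝ) • η) := fun η ↦ by
    by_cases hη : η ∈ S
    · obtain ⟨n, hn, h⟩ := exists_pos_isNSForm_nat_cast_smul_of_mem_span_rat Φ (hS' η hη)
      exact ⟨n, fun _ ↦ ⟨hn, h⟩⟩
    · exact ⟨1, fun h ↦ absurd h hη⟩
  choose n hn using hch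
  have hSsemipos : ∀ η ∈ S, ∀ v : E, 0 ≤ η ![I • v, v] := fun η hη ↦ by
    have h : η ∈ (Submodule.span ℝ≥0 (S : Set (E [⋀^Fin 2]→L[ℝ] ℝ)) : Set (E [⋀^Fin 2]→L[ℝ] ℝ)) :=
      Submodule.subset_span hη
    rw [hnef] at h
    exact h.2
  refine hS.finrank_neronSeveriGroup_eq_one_of_forall_semipos_mem_span_nnreal Φ hX
    ((S.image fun η ↦ (n η : ℝ) • η).finite_toSet) (fun θ hθ ↦ ?_) fun θ hθ hpsd ↦ ?_
  · rw [Finset.coe_image] at hθ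
    obtain ⟨η, hη, rfl⟩ := hθ
    refine ⟨(hn η hη).2, fun v ↦ ?_⟩
    rw [ContinuousAlternatingMap.smul_apply, smul_eq_mul]
    exact mul_nonneg (Nat.cast_nonneg _) (hSsemipos η hη v)
  · -- `θ ∈ Nef(X) = span_{ℝ≥0} S ⊆ span_{ℝ≥0} G`
    have hθS : θ ∈ Submodule.span ℝ≥0 (S : Set (E [⋀^Fin 2]→L[ℝ] ℝ)) := by
      have h : θ ∈ (Submodule.span ℝ≥0 (S : Set (E [⋀^Fin 2]→L[ℝ] ℝ)) : Set (E [⋀^Fin 2]→L[ℝ] ℝ)) := by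
        rw [hnef]
        exact ⟨Submodule.subset_span hθ, hpsd⟩
      exact h
    refine (Submodule.span_le.2 fun η hη ↦ ?_) hθS
    have hnpos : (0 : ℝ) < n η := by exact_mod_cast (hn η hη).1
    have hform : η = ((n η : ℝ))⁻¹ • ((n η : ℝ) • η) := by
      rw [smul_smul, inv_mul_cancel₀ hnpos.ne', one_smul]
    rw [hform]
    refine smul_mem_span_nnreal_of_nonneg (inv_nonneg.2 hnpos.le) (Submodule.subset_span ?_)
    rw [Finset.coe_image]
    exact ⟨η, hη, rfl⟩

/-- **Rational boundary classes of the nef cone of a simple abelian variety are `0`** (the mechanism of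
assertion (2.1), "`s ∉ ℚ`", of Bauer's proof: "The line bundle `nL` is then algebraically equivalent to an
effective (and integral) line bundle. But `L`, and hence `nL`, is certainly not ample, so that the kernel
`K(nL)` of `φ_{nL}` is of positive dimension … contradicting the simplicity assumption"): on a simple complex
torus, a class `θ ∈ NS_ℚ(X)` with `H_θ ≥ 0` and a non-zero isotropic vector is `0` — equivalently a nef
class of `NS_ℚ(X)` is `0` or ample. [cite: Bauer1998ConeOfCurves, §2 Prop. 2.2 (proof, assertion (2.1))] -/
theorem IsSimple.eq_zero_of_mem_span_rat_of_semipos_of_apply_I_smul_self_eq_zero (hS : IsSimple Φ)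
    {θ : E [⋀^Fin 2]→L[ℝ] ℝ} (hθ : θ ∈ Submodule.span ℚ {η : E [⋀^Fin 2]→L[ℝ] ℝ | IsNSForm Φ η})
    (hpsd : ∀ v : E, 0 ≤ θ ![I • v, v]) {w : E} (hw : w ≠ 0) (h0 : θ ![I • w, w] = 0) : θ = 0 := by
  obtain ⟨n, hn, hNS⟩ := exists_pos_isNSForm_nat_cast_smul_of_mem_span_rat Φ hθ
  have hnpos : (0 : ℝ) < n := by exact_mod_cast hn
  have hn0 : (n : ℝ) • θ = 0 := by
    refine hS.eq_zero_of_semipos_of_apply_I_smul_self_eq_zero Φ hNS (fun v ↦ ?_) hw ?_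
    · rw [ContinuousAlternatingMap.smul_apply, smul_eq_mul]
      exact mul_nonneg hnpos.le (hpsd v)
    · rw [ContinuousAlternatingMap.smul_apply, smul_eq_mul, h0, mul_zero]
  have h := congrArg (fun x : E [⋀^Fin 2]→L[ℝ] ℝ ↦ (n : ℝ)⁻¹ • x) hn0
  simpa only [smul_smul, inv_mul_cancel₀ hnpos.ne', one_smul, smul_zero] using h

/-- **On a simple complex torus a nef (= semi-positive) class of `NS_ℚ(X)` is `0` or ample (`H_θ > 0`)** — the
nef cone meets `NS_ℚ(X)` only in `0` and in the ample cone; its other boundary rays are irrational (cf. file 48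
§9, `IsSimple.irrational_sInf_setOf_semipos_smul_sub`). [cite: Bauer1998ConeOfCurves, §2 Prop. 2.2 (proof, assertion (2.1))] -/
theorem IsSimple.eq_zero_or_forall_pos_of_mem_span_rat_of_semipos (hS : IsSimple Φ)
    {θ : E [⋀^Fin 2]→L[ℝ] ℝ} (hθ : θ ∈ Submodule.span ℚ {η : E [⋀^Fin 2]→L[ℝ] ℝ | IsNSForm Φ η})
    (hpsd : ∀ v : E, 0 ≤ θ ![I • v, v]) : θ = 0 ∨ ∀ v : E, v ≠ 0 → 0 < θ ![I • v, v] := by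
  by_cases h : ∀ v : E, v ≠ 0 → 0 < θ ![I • v, v]
  · exact Or.inr h
  · push Not at h
    obtain ⟨w, hw, hle⟩ := h
    exact Or.inl (hS.eq_zero_of_mem_span_rat_of_semipos_of_apply_I_smul_self_eq_zero Φ hθ hpsd hw
      (le_antisymm hle (hpsd w)))

end Rational

section RationalNef

variable {ι : Type*} [Fintype ι] [DecidableEq ι] {E : Type u} [NormedAddCommGroup E] [InnerProductSpace ℂ E]
  [FiniteDimensional ℂ E] [MeasurableSpace E] [BorelSpace E] (Φ : (ι → ℝ) ≃L[ℝ] E)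

omit [Fintype ι] [DecidableEq ι] [FiniteDimensional ℂ E] [MeasurableSpace E] [BorelSpace E] in
/-- `NS_ℚ(X) ⊆ NS_ℝ(X)`: the `ℚ`-span of `NS(X)` lies in its `ℝ`-span. [folklore] -/
private theorem mem_span_real_of_mem_span_rat {θ : E [⋀^Fin 2]→L[ℝ] ℝ}
    (hθ : θ ∈ Submodule.span ℚ {η : E [⋀^Fin 2]→L[ℝ] ℝ | IsNSForm Φ η}) :
    θ ∈ Submodule.span ℝ {η : E [⋀^Fin 2]→L[ℝ] ℝ | IsNSForm Φ η} := by
  induction hθ using Submodule.span_induction with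
  | mem η hη => exact Submodule.subset_span hη
  | zero => exact Submodule.zero_mem _
  | add x y _ _ ihx ihy => exact Submodule.add_mem _ ihx ihy
  | smul q x _ ih =>
    rw [← Rat.cast_smul_eq_qsmul ℝ q x]
    exact Submodule.smul_mem _ _ ih

/-- **On a simple abelian variety a nef `ℚ`-line bundle is numerically trivial or ample**: for
`θ ∈ NS_ℚ(X)` with `Re ∫_C ofRealForm(-θ) ≥ 0` on every irreducible curve `C`, `θ = 0` or `H_θ > 0` (nef ⇒
`H_θ ≥ 0` for real classes, file 49 §2; then the previous theorem). [cite: Bauer1998ConeOfCurves, §2 Prop. 2.2 (proof, assertion (2.1))] -/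
theorem IsSimple.eq_zero_or_forall_pos_of_mem_span_rat_of_forall_curve_nonneg (hS : IsSimple Φ)
    (hX : IsAbelianVariety Φ) {g : ℕ} (e : Fin (2 * g) ≃ ι) {θ : E [⋀^Fin 2]→L[ℝ] ℝ}
    (hθ : θ ∈ Submodule.span ℚ {η : E [⋀^Fin 2]→L[ℝ] ℝ | IsNSForm Φ η})
    (hnef : ∀ (C : Set (ComplexTorus Φ)) (hC : HasPureDim 𝓘(ℂ, E) C 1), IsIrreducibleAnalyticSet 𝓘(ℂ, E) C →
      0 ≤ (analyticCyclePeriod Φ hC (ofRealForm (-θ))).re) :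
    θ = 0 ∨ ∀ v : E, v ≠ 0 → 0 < θ ![I • v, v] :=
  hS.eq_zero_or_forall_pos_of_mem_span_rat_of_semipos Φ hθ
    ((hX.semipos_iff_forall_curve_of_mem_span Φ e (mem_span_real_of_mem_span_rat Φ hθ)).2 hnef)

/-- **The Theorem, (ib) ⇒ (ii), rational generators and the nef cone by curves**: on a simple abelian variety
`X ≠ 0`, if `Nef(X) = {θ ∈ NS_ℝ(X) | Re ∫_C ofRealForm(-θ) ≥ 0 for all irreducible C}` is the `ℝ≥0`-span of
finitely many classes of `NS_ℚ(X)`, then `rk NS(X) = 1`. [cite: Bauer1998ConeOfCurves, §1 Theorem ((ib) ⇒ (ii)), §2 Prop. 2.2, §4 (the nef cone)] -/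
theorem IsSimple.finrank_neronSeveriGroup_eq_one_of_span_nnreal_eq_nef_of_subset_span_rat [Nontrivial E]
    (hS : IsSimple Φ) (hX : IsAbelianVariety Φ) {g : ℕ} (e : Fin (2 * g) ≃ ι) {S : Finset (E [⋀^Fin 2]→L[ℝ] ℝ)}
    (hS' : ∀ η ∈ S, η ∈ Submodule.span ℚ {η : E [⋀^Fin 2]→L[ℝ] ℝ | IsNSForm Φ η})
    (hnef : (Submodule.span ℝ≥0 (S : Set (E [⋀^Fin 2]→L[ℝ] ℝ)) : Set (E [⋀^Fin 2]→L[ℝ] ℝ)) =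
      {θ : E [⋀^Fin 2]→L[ℝ] ℝ | θ ∈ Submodule.span ℝ {η : E [⋀^Fin 2]→L[ℝ] ℝ | IsNSForm Φ η} ∧
        ∀ (C : Set (ComplexTorus Φ)) (hC : HasPureDim 𝓘(ℂ, E) C 1), IsIrreducibleAnalyticSet 𝓘(ℂ, E) C →
          0 ≤ (analyticCyclePeriod Φ hC (ofRealForm (-θ))).re}) :
    finrank ℤ (neronSeveriGroup Φ) = 1 := by
  rw [hX.setOf_mem_span_forall_curve_nonneg_eq Φ e] at hnef
  exact hS.finrank_neronSeveriGroup_eq_one_of_span_nnreal_eq_of_subset_span_rat Φ hX hS' hnef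

end RationalNef

end ComplexTorus

end Literature.Geometry.Kaehler

end
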